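import Summits.NavierStokesRegularity.NavierStokesRegularity.Theorems.ExtremiserTransienceFilamentGapSliceTools
import Literature.Analysis.FluidPDE.TypeIRateScaledEnergyBoundUniform
import Literature.Analysis.FluidPDE.LeraySuitableWeakSolutions
import Literature.Analysis.FluidPDE.NSWeakStrongUniquenessHolds
import Literature.Analysis.FluidPDE.TaoLocalisationHolds
import Literature.Analysis.FluidPDE.TaoLocalisationProofs
import Literature.Analysis.FluidPDE.LocalTypeICongr
import Literature.Analysis.FluidPDE.KatoMaximalTimeSingular
import Literature.Analysis.FluidPDE.LerayHopfProofs
import Literature.Analysis.FluidPDE.NSLerayHopfABCScaling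
import Literature.Analysis.FluidPDE.NSViscosityRescaling
import Literature.Analysis.FluidPDE.SereginSverak2002PressureLowerBoundProofs
import HarnessLib

/-!
# Route `ExtremiserTransience`, crux `NearExtremalTransiencePerFlow` (stmt-NavierStokesRegularity-26567) —
# LINE g9-α «filament budget ⊕ chain gap», stub F1 `stub_flowFilamentBudget`: THE FILAMENT BUDGET

`--supports stmt-NavierStokesRegularity-26567`.  Prover seat ns-net-p2 (g5).  THE STATEMENT (`flowFilamentBudget`,
verbatim the Prop `FlowFilamentBudget` of the crux workfile `Cruxes/NearExtremalTransiencePerFlow/Lines/filament_gap.lean`,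
§1): a classical solution of the Navier–Stokes equations on `[0,T) × ℝ³` (viscosity `ν > 0`) from a rapidly decaying
Leray–Hopf datum, with the eventual Type-I rate `√(T−t)‖u(t)‖_∞ ≤ C√ν`, has BOUNDED SCALE-INVARIANT LOCAL ENERGY near `T`:
for some `A` and all late `t`, `∫_{B(x,r)} |u(t)|² ≤ A·ν²·r` for EVERY centre `x` and EVERY radius `r > 0`.

PROOF (all inputs are landed theorems; nothing about regularity or blow-up is proved):
* middle radii `√(T−t) < r < r₀/2` — Seregin 2014 Prop. 3.11 (i) / Seregin–Šverák 2009 Lemma 3.5 in the tree's uniform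
  form `Literature.Analysis.FluidPDE.scaledEnergies_bounded_of_typeIRate_unif` (the `L∞` Type-I rate on a backward
  cylinder bounds `A + E + C + D` at its vertex, with a constant depending only on the rate constant and on bounds for
  `C(r₀)`, `D(r₀)`), applied at the vertex `(T, x)` to the Leray continuation `(v, q)` of the datum (suitable on
  `(0, T+1) × ℝ³`, `v = u` a.e. on `(0,T) × ℝ³` by weak–strong uniqueness, `v ∈ L³`, `q ∈ L^{3/2}` of the strip — the
  bridge of the landed `Theorems.…TypeIRateCeiling`), the background bounds `r₀⁻² ∫∫_{(0,T)×ℝ³} |v|³`,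
  `r₀⁻² ∫∫ |q|^{3/2}` being uniform in the centre; the `esssup_t` bound on `r⁻¹∫_{B(x,r)}|u(t)|²` holds at EVERY `t` by
  continuity of the slice energy (`u` is jointly continuous below `T`);
* small radii `r² ≤ T − t` — the sup bound, `∫_{B(x,r)}|u(t)|² ≤ |B₁| r³ C²ν/(T−t) ≤ |B₁| C² ν r`;
* large radii `r ≥ r₀/2` — the energy inequality, `∫ |u(t)|² ≤ ∫ |u(0)|²`;
* the viscosity is normalised to `1` and back (`IsClassicalNSSolutionOn.viscosityRescale_set`,
  `IsLerayHopfOn.viscosityRescale`), which produces the factor `ν²`.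

No summit is proved by a line; crux 26567, F2 `stub_chainGap` and Navier–Stokes regularity stay OPEN.
-/

noncomputable section

open MeasureTheory Filter Set Metric Function Topology TopologicalSpace
open scoped ENNReal NNReal Topology
open Literature.Analysis.FluidPDE

namespace Summit.NavierStokesRegularity.NavierStokesRegularity.Theorems

set_option linter.dupNamespace false

namespace NearExtremalTransiencePerFlow.FilamentGap

/-! ## §2 The filament budget at unit viscosity -/

/-- **The filament budget, unit viscosity.** A classical solution on `[0,T) × ℝ³` (`ν = 1`), Leray–Hopf from the
rapidly decaying datum `u 0`, with `√(T−t)‖u(t,x)‖ ≤ C` for all `x` and all `t ∈ (t₁, T)`, satisfies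
`∫_{B(x,r)}|u(t)|² ≤ A r` for all `x`, all `r > 0` and all `t ∈ (t₂, T)`, for some `A` and some `t₂ < T`.
Middle radii: Seregin 2014 Prop. 3.11 (i) in the uniform form `scaledEnergies_bounded_of_typeIRate_unif` at the
vertex `(T, x)` for the Leray continuation of the datum (bridge as in `Theorems.…TypeIRateCeiling`); small radii: the
sup bound; large radii: the energy inequality. [cite: Seregin2014, Ch. 6 §6.3 Prop. 3.11 (i)]
[cite: SereginSverak2009, Lemma 3.5] -/
theorem flowFilamentBudget_unit {T C t₁ : ℝ} (hT : 0 < T) (ht₁ : t₁ < T)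
    {u : ℝ → EuclideanSpace ℝ (Fin 3) → EuclideanSpace ℝ (Fin 3)} {p : ℝ → EuclideanSpace ℝ (Fin 3) → ℝ}
    (hcl : IsClassicalNSSolutionOn (Ico 0 T) 1 0 u p) (hLH : IsLerayHopfOn T 1 0 (u 0) u)
    (hdec : HasRapidSpatialDecay (u 0))
    (hrate : ∀ t ∈ Ioo t₁ T, ∀ x, Real.sqrt (T - t) * ‖u t x‖ ≤ C) :
    ∃ A t₂ : ℝ, t₂ < T ∧ ∀ t ∈ Ioo t₂ T, ∀ (x : EuclideanSpace ℝ (Fin 3)) (r : ℝ), 0 < r →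
      ∫ y in ball x r, ‖u t y‖ ^ 2 ≤ A * r := by
  -- ### the Leray continuation: a global suitable Leray–Hopf solution from `u 0`
  have hu0 : MemLp (u 0) 2 volume := hLH.memLp 0 ⟨le_rfl, hT.le⟩
  have hdiv : IsWeaklyDivFree (u 0) := hLH.isWeaklyDivFree_datum hT
  obtain ⟨v, q, hGL, -, hvmeas, -, hq32, hv3, hLE⟩ :=
    exists_isGlobalLerayHopf_and_isLocalEnergySolutionOn (zero_lt_one : (0 : ℝ) < 1) hu0 hdiv
  -- ### weak–strong uniqueness on `[0, T']`, `T' < T`: `v(t) = u(t)` a.e. for `0 < t < T`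
  have hslice : ∀ t ∈ Ioo 0 T, v t =ᵐ[volume] u t := by
    intro t ht
    have hT' : (t + T) / 2 ∈ Ioo 0 T := ⟨by linarith [ht.1], by linarith [ht.2]⟩
    have hS : MemLqLp ⊤ ⊤ u (Ioo 0 ((t + T) / 2)) :=
      tao2011_hasBoundedSobolevNormsOn.memLqLp_top tao2011_hasBoundedSobolevNormsOn_holds
        linfty_bound_of_hasBoundedSobolevNormsOn_holds 1 T zero_lt_one hT u p hcl hLH hdec _ hT'
    have hu' : IsLerayHopfOn ((t + T) / 2) 1 0 (u 0) u := hLH.of_le hT'.2.le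
    have hv' : IsLerayHopfOn ((t + T) / 2) 1 0 (u 0) v := hGL _ hT'.1
    have h3 : (3 : ℝ≥0∞) < ⊤ := ENNReal.ofNat_lt_top
    have hqr : 2 / (⊤ : ℝ≥0∞) + 3 / (⊤ : ℝ≥0∞) ≤ 1 := by simp
    exact weak_strong_uniqueness_holds zero_lt_one hT'.1 hu' h3 hqr hS hv' t
      ⟨ht.1, by linarith [ht.2]⟩
  -- ### space–time a.e. equality on the strip `(0, T) × ℝ³`
  have hcontu : ContinuousOn (uncurry u) (Ico 0 T ×ˢ (univ : Set (EuclideanSpace ℝ (Fin 3)))) :=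
    hcl.smooth_velocity.continuousOn
  have hcont : ContinuousOn (uncurry u) (Ioo 0 T ×ˢ (univ : Set (EuclideanSpace ℝ (Fin 3)))) :=
    hcontu.mono (Set.prod_mono Ioo_subset_Ico_self Subset.rfl)
  have humeas : AEStronglyMeasurable (uncurry u)
      (volume.restrict (Ioo 0 T ×ˢ (univ : Set (EuclideanSpace ℝ (Fin 3))))) :=
    hcont.aestronglyMeasurable (measurableSet_Ioo.prod MeasurableSet.univ)
  have hvmeas' : AEStronglyMeasurable (uncurry v)
      (volume.restrict (Ioo 0 T ×ˢ (univ : Set (EuclideanSpace ℝ (Fin 3))))) := by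
    have e : ((volume : Measure ℝ).restrict (Ioi 0)).prod (volume : Measure (EuclideanSpace ℝ (Fin 3))) =
        volume.restrict (Ioi (0 : ℝ) ×ˢ (univ : Set (EuclideanSpace ℝ (Fin 3)))) := by
      rw [Measure.volume_eq_prod, ← Measure.restrict_univ (μ := (volume : Measure (EuclideanSpace ℝ (Fin 3)))),
        Measure.prod_restrict, Measure.restrict_univ]
    rw [e] at hvmeas
    exact hvmeas.mono_measure
      (Measure.restrict_mono (Set.prod_mono Ioo_subset_Ioi_self Subset.rfl) le_rfl)
  have hae : uncurry v =ᵐ[volume.restrict (Ioo 0 T ×ˢ (univ : Set (EuclideanSpace ℝ (Fin 3))))] uncurry u :=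
    ae_restrict_prod_of_forall_ae_eq hslice hvmeas' humeas
  -- ### on the open slab `Q = (0, T+1) × ℝ³` the pair `(v, q)` is suitable
  have hsw : IsSuitableWeakSolutionOn
      (slab (EuclideanSpace ℝ (Fin 3)) (Ioo 0 (T + 1)) isOpen_Ioo) 1 0 v q :=
    (hLE (T + 1) (by linarith)).suitable
  obtain ⟨G, hGw, -, -⟩ := hsw.localEnergy
  -- backward cylinders of radius `r`, `r² < T`, at a vertex `(T, x₀)` lie in the strip `(0, T) × ℝ³`
  have hcylT : ∀ {x₀ : EuclideanSpace ℝ (Fin 3)} {r : ℝ}, r ^ 2 < T →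
      parabolicCylinder r ((T, x₀) : ℝ × (EuclideanSpace ℝ (Fin 3))) ⊆
        Ioo 0 T ×ˢ (univ : Set (EuclideanSpace ℝ (Fin 3))) := by
    intro x₀ r hrT w hw
    rw [mem_parabolicCylinder] at hw
    have hw1 : T - r ^ 2 < w.1 := hw.1.1
    have hw2 : w.1 < T := hw.1.2
    exact ⟨⟨by linarith, hw2⟩, mem_univ _⟩
  -- ### the onset `t₂` and the base radius `r₀`
  set t₂ : ℝ := max t₁ 0 with ht₂
  have ht₂T : t₂ < T := max_lt ht₁ hT
  set d : ℝ := T - t₂ with hd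
  have hd0 : 0 < d := by rw [hd]; linarith
  set r₀ : ℝ := Real.sqrt d / 2 with hr₀
  have hr₀0 : 0 < r₀ := div_pos (Real.sqrt_pos.2 hd0) two_pos
  have hr₀sq : r₀ ^ 2 = d / 4 := by
    rw [hr₀, div_pow, Real.sq_sqrt hd0.le]; norm_num
  have hrd : ∀ {r : ℝ}, 0 < r → r ≤ r₀ → t₂ < T - r ^ 2 := by
    intro r hr hrr₀
    have h1 : r ^ 2 ≤ r₀ ^ 2 := pow_le_pow_left₀ hr.le hrr₀ 2
    rw [hr₀sq] at h1
    have h2 : d / 4 < d := by linarith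
    rw [hd] at h1 h2
    linarith
  have hrT : ∀ {r : ℝ}, 0 < r → r ≤ r₀ → r ^ 2 < T := by
    intro r hr hrr₀
    have := hrd hr hrr₀
    have h0 : (0 : ℝ) ≤ t₂ := le_max_right _ _
    linarith
  have hr₀T : r₀ ^ 2 < T := hrT hr₀0 le_rfl
  have hcylQ : ∀ x₀ : EuclideanSpace ℝ (Fin 3),
      parabolicCylinder r₀ ((T, x₀) : ℝ × (EuclideanSpace ℝ (Fin 3))) ⊆
      ((slab (EuclideanSpace ℝ (Fin 3)) (Ioo 0 (T + 1)) isOpen_Ioo :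
        Opens (ℝ × (EuclideanSpace ℝ (Fin 3)))) : Set (ℝ × (EuclideanSpace ℝ (Fin 3)))) := by
    intro x₀ w hw
    have hw' := hcylT hr₀T hw
    show w ∈ Ioo 0 (T + 1) ×ˢ (univ : Set (EuclideanSpace ℝ (Fin 3)))
    exact ⟨⟨hw'.1.1, by linarith [hw'.1.2]⟩, mem_univ _⟩
  -- ### uniform background bounds `C(r₀; v) ≤ C₀`, `D(r₀; q) ≤ D₀` at every vertex `(T, x₀)`
  have hinv : (ENNReal.ofReal r₀ ^ 2)⁻¹ ≠ ⊤ :=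
    ENNReal.inv_ne_top.2 (pow_ne_zero _ (ENNReal.ofReal_pos.2 hr₀0).ne')
  have hI₃ := hv3 T hT
  have hI₂ := hq32 T hT
  set C₀ : ℝ≥0 := ((ENNReal.ofReal r₀ ^ 2)⁻¹ *
    ∫⁻ z in Ioo 0 T ×ˢ (univ : Set (EuclideanSpace ℝ (Fin 3))), ‖v z.1 z.2‖ₑ ^ 3).toNNReal with hC₀def
  set D₀ : ℝ≥0 := ((ENNReal.ofReal r₀ ^ 2)⁻¹ *
    ∫⁻ z in Ioo 0 T ×ˢ (univ : Set (EuclideanSpace ℝ (Fin 3))), ‖q z.1 z.2‖ₑ ^ (3 / 2 : ℝ)).toNNReal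
    with hD₀def
  have hC₀ : ∀ x₀ : EuclideanSpace ℝ (Fin 3),
      cknC r₀ ((T, x₀) : ℝ × (EuclideanSpace ℝ (Fin 3))) v ≤ C₀ := by
    intro x₀
    rw [hC₀def, ENNReal.coe_toNNReal (ENNReal.mul_ne_top hinv hI₃.ne)]
    exact mul_le_mul' le_rfl (lintegral_mono_set (hcylT hr₀T))
  have hD₀ : ∀ x₀ : EuclideanSpace ℝ (Fin 3),
      cknD r₀ ((T, x₀) : ℝ × (EuclideanSpace ℝ (Fin 3))) q ≤ D₀ := by
    intro x₀
    rw [hD₀def, ENNReal.coe_toNNReal (ENNReal.mul_ne_top hinv hI₂.ne)]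
    exact mul_le_mul' le_rfl (lintegral_mono_set (hcylT hr₀T))
  -- ### Seregin 2014 Prop. 3.11 (i), uniform constant
  obtain ⟨K, hK⟩ := scaledEnergies_bounded_of_typeIRate_unif C C₀ D₀
  -- ### the rate `√(T - t) ‖v‖ ≤ C` a.e. on `Q_{r₀}(T, x₀)` (there `v = u` a.e. and `t₁ < t < T`)
  have hratev : ∀ x₀ : EuclideanSpace ℝ (Fin 3),
      ∀ᵐ w ∂(volume.restrict (parabolicCylinder r₀ ((T, x₀) : ℝ × (EuclideanSpace ℝ (Fin 3))))),
        Real.sqrt (((T, x₀) : ℝ × (EuclideanSpace ℝ (Fin 3))).1 - w.1) * ‖v w.1 w.2‖ ≤ C := by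
    intro x₀
    have hae' : ∀ᵐ w ∂(volume.restrict (parabolicCylinder r₀ ((T, x₀) : ℝ × (EuclideanSpace ℝ (Fin 3))))),
        uncurry v w = uncurry u w :=
      ae_restrict_of_ae_restrict_of_subset (hcylT hr₀T) hae
    filter_upwards [hae', ae_restrict_mem (isOpen_parabolicCylinder r₀ _).measurableSet] with w hw hwQ
    have hw' : v w.1 w.2 = u w.1 w.2 := hw
    rw [mem_parabolicCylinder] at hwQ
    have hw1 : T - r₀ ^ 2 < w.1 := hwQ.1.1
    have hw2 : w.1 < T := hwQ.1.2
    have hwt₁ : t₁ < w.1 := lt_of_le_of_lt (le_max_left _ _) ((hrd hr₀0 le_rfl).trans hw1)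
    show Real.sqrt (T - w.1) * ‖v w.1 w.2‖ ≤ C
    rw [hw']
    exact hrate w.1 ⟨hwt₁, hw2⟩ w.2
  -- ### `A(Q_r(T, x₀); u) ≤ K` for `0 < r < r₀ / 2`
  have hAK : ∀ x₀ : EuclideanSpace ℝ (Fin 3), ∀ r ∈ Ioo 0 (r₀ / 2),
      cknAEss r ((T, x₀) : ℝ × (EuclideanSpace ℝ (Fin 3))) u ≤ K := by
    intro x₀ r hr
    have hrr₀ : r ≤ r₀ := hr.2.le.trans (half_le_self hr₀0.le)
    have h := hK hsw hGw hr₀0 (hcylQ x₀) (hC₀ x₀) (hD₀ x₀) (hratev x₀) r hr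
    have hA : cknAEss r ((T, x₀) : ℝ × (EuclideanSpace ℝ (Fin 3))) v ≤ K :=
      le_trans (le_add_right (le_add_right (le_add_right le_rfl))) h
    have hae' : ∀ᵐ w ∂(volume.restrict (parabolicCylinder r ((T, x₀) : ℝ × (EuclideanSpace ℝ (Fin 3))))),
        uncurry v w = uncurry u w :=
      ae_restrict_of_ae_restrict_of_subset (hcylT (hrT hr.1 hrr₀)) hae
    rw [← cknAEss_congr_ae hae']
    exact hA
  -- ### the slice bound at EVERY `t ∈ (T - r², T)`
  have hsliceK : ∀ x₀ : EuclideanSpace ℝ (Fin 3), ∀ r ∈ Ioo 0 (r₀ / 2), ∀ t ∈ Ioo (T - r ^ 2) T,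
      ∫ y in ball x₀ r, ‖u t y‖ ^ 2 ≤ K * r := by
    intro x₀ r hr
    have hrr₀ : r ≤ r₀ := hr.2.le.trans (half_le_self hr₀0.le)
    have hr2T : r ^ 2 < T := hrT hr.1 hrr₀
    have hIoo : Ioo (T - r ^ 2) T ⊆ Ioo 0 T := Ioo_subset_Ioo_left (by linarith)
    have hcs : ∀ t ∈ Ioo (T - r ^ 2) T, Continuous (u t) := fun t ht =>
      hcontu.comp_continuous (continuous_const.prodMk continuous_id)
        fun y => ⟨Ioo_subset_Ico_self (hIoo ht), mem_univ y⟩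
    exact le_of_ae_le_of_continuousAt (fun t ht => continuousAt_ballEnergy hcontu x₀ r (hIoo ht))
      (ae_ballEnergy_le_of_cknAEss_le hr.1 (hAK x₀ r hr) hcs)
  -- ### assembly of the three regimes
  set E₀ : ℝ := 2 * VectorCalculus.kineticEnergy (u 0) with hE₀
  set V₁ : ℝ := (volume (ball (0 : EuclideanSpace ℝ (Fin 3)) 1)).toReal with hV₁
  have hE₀0 : 0 ≤ E₀ := mul_nonneg zero_le_two (kineticEnergy_nonneg _)
  have hE₀' : 0 ≤ E₀ * (2 / r₀) := mul_nonneg hE₀0 (by positivity)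
  have hK0 : 0 ≤ (K : ℝ) := K.coe_nonneg
  have hV₁0 : 0 ≤ V₁ * C ^ 2 := mul_nonneg ENNReal.toReal_nonneg (sq_nonneg _)
  refine ⟨E₀ * (2 / r₀) + K + V₁ * C ^ 2, t₂, ht₂T, fun t ht x r hr => ?_⟩
  have ht0 : 0 < t := lt_of_le_of_lt (le_max_right _ _) ht.1
  have htT : t < T := ht.2
  have ht₁t : t₁ < t := lt_of_le_of_lt (le_max_left _ _) ht.1
  rcases le_or_gt (r₀ / 2) r with hbig | hsmall
  · -- large radii: the energy inequality
    have h1 := ballEnergy_le_energy zero_le_one hLH ⟨ht0.le, htT.le⟩ x r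
    have h2 : E₀ ≤ E₀ * (2 / r₀) * r := by
      have h : 1 ≤ 2 / r₀ * r := by
        rw [div_mul_eq_mul_div, le_div_iff₀ hr₀0]; linarith
      calc E₀ = E₀ * 1 := (mul_one _).symm
        _ ≤ E₀ * (2 / r₀ * r) := mul_le_mul_of_nonneg_left h hE₀0
        _ = E₀ * (2 / r₀) * r := by ring
    calc ∫ y in ball x r, ‖u t y‖ ^ 2 ≤ E₀ := h1
      _ ≤ E₀ * (2 / r₀) * r := h2
      _ ≤ (E₀ * (2 / r₀) + K + V₁ * C ^ 2) * r :=
          mul_le_mul_of_nonneg_right (by linarith) hr.le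
  · rcases lt_or_ge (T - t) (r ^ 2) with hmid | hsm
    · -- middle radii: Seregin's scaled energy bound
      calc ∫ y in ball x r, ‖u t y‖ ^ 2 ≤ K * r := hsliceK x r ⟨hr, hsmall⟩ t ⟨by linarith, htT⟩
        _ ≤ (E₀ * (2 / r₀) + K + V₁ * C ^ 2) * r :=
            mul_le_mul_of_nonneg_right (by linarith) hr.le
    · -- small radii: the sup bound
      calc ∫ y in ball x r, ‖u t y‖ ^ 2 ≤ V₁ * C ^ 2 * r :=
            ballEnergy_le_of_rate (sub_pos.2 htT) (hrate t ⟨ht₁t, htT⟩) hr hsm x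
        _ ≤ (E₀ * (2 / r₀) + K + V₁ * C ^ 2) * r :=
            mul_le_mul_of_nonneg_right (by linarith) hr.le

/-! ## §3 Every viscosity: the statement `FlowFilamentBudget` of the line -/

/-- **F1 `stub_flowFilamentBudget` — THE FILAMENT BUDGET** (verbatim the Prop `FlowFilamentBudget` of
`Cruxes/NearExtremalTransiencePerFlow/Lines/filament_gap.lean`, LINE g9-α).  A classical solution on `[0,T) × ℝ³`
with viscosity `ν > 0`, Leray–Hopf from the rapidly decaying datum `u 0`, with the eventual Type-I rate
`√(T−t)‖u(t,x)‖ ≤ C√ν`, has bounded scale-invariant local energy near `T`: for some `A` and all late `t`,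
`∫_{B(x,r)}|u(t)|² ≤ A·ν²·r` for every `x` and every `r > 0`.  Proof: normalise the viscosity
(`w(s,y) = ν⁻¹u(s/ν,y)`, rate `C`, `IsClassicalNSSolutionOn.viscosityRescale_set`, `IsLerayHopfOn.viscosityRescale`),
apply `flowFilamentBudget_unit`, and scale back (`∫_{B(x,r)}|u(t)|² = ν² ∫_{B(x,r)}|w(νt)|²`).
[cite: Seregin2014, Ch. 6 §6.3 Prop. 3.11 (i)] [cite: SereginSverak2009, Lemma 3.5] -/
theorem flowFilamentBudget :
    ∀ (C ν T : ℝ), 0 < C → 0 < ν → 0 < T →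
    ∀ (u : ℝ → EuclideanSpace ℝ (Fin 3) → EuclideanSpace ℝ (Fin 3)) (p : ℝ → EuclideanSpace ℝ (Fin 3) → ℝ),
    IsClassicalNSSolutionOn (Set.Ico 0 T) ν 0 u p → IsLerayHopfOn T ν 0 (u 0) u → HasRapidSpatialDecay (u 0) →
    (∀ᶠ t in 𝓝[<] T, ∀ x, Real.sqrt (T - t) * ‖u t x‖ ≤ C * Real.sqrt ν) →
    ∃ A : ℝ, ∀ᶠ t in 𝓝[<] T, ∀ (x : EuclideanSpace ℝ (Fin 3)) (r : ℝ), 0 < r →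
      ∫ y in Metric.ball x r, ‖u t y‖ ^ 2 ≤ A * ν ^ 2 * r := by
  intro C ν T _hC hν hT u p hcl hLH hdec hrate
  -- the rate on an interval `(t₁, T)`
  obtain ⟨t₁, ht₁T, hsub⟩ := mem_nhdsLT_iff_exists_Ioo_subset.1 hrate
  have ht₁T' : t₁ < T := ht₁T
  -- ### normalise the viscosity: `w(s, y) = ν⁻¹ u(s/ν, y)`, `q(s, y) = ν⁻² p(s/ν, y)` on `[0, νT)`
  have hνT : 0 < ν * T := mul_pos hν hT
  have hcl' : IsClassicalNSSolutionOn (Ico 0 (ν * T)) 1 0 (timeRescale ν⁻¹ ν⁻¹ u)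
      (timeRescale ν⁻¹ (ν⁻¹ ^ 2) p) := by
    have hmaps : MapsTo (fun r => ν⁻¹ * r) (Ico 0 (ν * T)) (Ico 0 T) := by
      intro r hr
      refine ⟨mul_nonneg (inv_nonneg.2 hν.le) hr.1, ?_⟩
      calc ν⁻¹ * r < ν⁻¹ * (ν * T) := mul_lt_mul_of_pos_left hr.2 (inv_pos.2 hν)
        _ = T := by rw [← mul_assoc, inv_mul_cancel₀ hν.ne', one_mul]
    simpa using hcl.viscosityRescale_set hν.ne' hmaps (uniqueDiffOn_Ico 0 (ν * T))
  have hw0 : timeRescale ν⁻¹ ν⁻¹ u 0 = ν⁻¹ • u 0 := by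
    funext y; simp [timeRescale_apply]
  have hLH' : IsLerayHopfOn (ν * T) 1 0 (timeRescale ν⁻¹ ν⁻¹ u 0) (timeRescale ν⁻¹ ν⁻¹ u) := by
    have h := hLH.viscosityRescale (inv_pos.2 hν)
    rw [div_inv_eq_mul, mul_comm T ν, inv_mul_cancel₀ hν.ne', timeRescale_zero_force, ← hw0] at h
    exact h
  have hdec' : HasRapidSpatialDecay (timeRescale ν⁻¹ ν⁻¹ u 0) := by
    rw [hw0]
    exact SereginSverak2002_pressureOneSidedBound.hasRapidSpatialDecay_const_smul
      (hcl.contDiff_velocity ⟨le_rfl, hT⟩) hdec ν⁻¹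
  -- the rate for `w` with constant `C` on `(ν t₁, ν T)`
  have hsqν : Real.sqrt ν * Real.sqrt ν = ν := Real.mul_self_sqrt hν.le
  have hrate' : ∀ s ∈ Ioo (ν * t₁) (ν * T), ∀ y,
      Real.sqrt (ν * T - s) * ‖timeRescale ν⁻¹ ν⁻¹ u s y‖ ≤ C := by
    intro s hs y
    have ht : ν⁻¹ * s ∈ Ioo t₁ T := by
      constructor
      · calc t₁ = ν⁻¹ * (ν * t₁) := by rw [← mul_assoc, inv_mul_cancel₀ hν.ne', one_mul]
          _ < ν⁻¹ * s := mul_lt_mul_of_pos_left hs.1 (inv_pos.2 hν)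
      · calc ν⁻¹ * s < ν⁻¹ * (ν * T) := mul_lt_mul_of_pos_left hs.2 (inv_pos.2 hν)
          _ = T := by rw [← mul_assoc, inv_mul_cancel₀ hν.ne', one_mul]
    have h := hsub ht y
    have hTs : ν * T - s = ν * (T - ν⁻¹ * s) := by
      rw [mul_sub, ← mul_assoc, mul_inv_cancel₀ hν.ne', one_mul]
    rw [timeRescale_apply, norm_smul, Real.norm_eq_abs, abs_of_pos (inv_pos.2 hν), hTs,
      Real.sqrt_mul hν.le]
    calc Real.sqrt ν * Real.sqrt (T - ν⁻¹ * s) * (ν⁻¹ * ‖u (ν⁻¹ * s) y‖)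
        = ν⁻¹ * Real.sqrt ν * (Real.sqrt (T - ν⁻¹ * s) * ‖u (ν⁻¹ * s) y‖) := by ring
      _ ≤ ν⁻¹ * Real.sqrt ν * (C * Real.sqrt ν) :=
          mul_le_mul_of_nonneg_left h (mul_nonneg (inv_nonneg.2 hν.le) (Real.sqrt_nonneg _))
      _ = C * (ν⁻¹ * (Real.sqrt ν * Real.sqrt ν)) := by ring
      _ = C := by rw [hsqν, inv_mul_cancel₀ hν.ne', mul_one]
  -- ### the unit-viscosity budget for `w`, scaled back
  obtain ⟨A, s₂, hs₂T, hA⟩ := flowFilamentBudget_unit hνT (mul_lt_mul_of_pos_left ht₁T' hν)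
    hcl' hLH' hdec' hrate'
  refine ⟨A, ?_⟩
  have hs₂ν : ν⁻¹ * s₂ < T := by
    calc ν⁻¹ * s₂ < ν⁻¹ * (ν * T) := mul_lt_mul_of_pos_left hs₂T (inv_pos.2 hν)
      _ = T := by rw [← mul_assoc, inv_mul_cancel₀ hν.ne', one_mul]
  filter_upwards [Ioo_mem_nhdsLT hs₂ν] with t ht x r hr
  have hs : ν * t ∈ Ioo s₂ (ν * T) := by
    constructor
    · calc s₂ = ν * (ν⁻¹ * s₂) := by rw [← mul_assoc, mul_inv_cancel₀ hν.ne', one_mul]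
        _ < ν * t := mul_lt_mul_of_pos_left ht.1 hν
    · exact mul_lt_mul_of_pos_left ht.2 hν
  have h := hA (ν * t) hs x r hr
  have hwt : ∀ y, ‖u t y‖ ^ 2 = ν ^ 2 * ‖timeRescale ν⁻¹ ν⁻¹ u (ν * t) y‖ ^ 2 := by
    intro y
    rw [timeRescale_apply, ← mul_assoc, inv_mul_cancel₀ hν.ne', one_mul, norm_smul, mul_pow,
      Real.norm_eq_abs, abs_of_pos (inv_pos.2 hν), ← mul_assoc, ← mul_pow,
      mul_inv_cancel₀ hν.ne', one_pow, one_mul]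
  calc ∫ y in ball x r, ‖u t y‖ ^ 2
      = ∫ y in ball x r, ν ^ 2 * ‖timeRescale ν⁻¹ ν⁻¹ u (ν * t) y‖ ^ 2 :=
        setIntegral_congr_fun measurableSet_ball fun y _ => hwt y
    _ = ν ^ 2 * ∫ y in ball x r, ‖timeRescale ν⁻¹ ν⁻¹ u (ν * t) y‖ ^ 2 := integral_const_mul _ _
    _ ≤ ν ^ 2 * (A * r) := mul_le_mul_of_nonneg_left h (sq_nonneg _)
    _ = A * ν ^ 2 * r := by ring


end NearExtremalTransiencePerFlow.FilamentGap

end Summit.NavierStokesRegularity.NavierStokesRegularity.Theorems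

end
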